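import Summits.BirchSwinnertonDyer.BirchSwinnertonDyer.Theorems.WildThreeRankOneBSDpOfExactIndexManin
import Literature.NumberTheory.EllipticCurves.KolyvaginShaIndexBound
import Literature.NumberTheory.EllipticCurves.BSDHeegnerPointsGrossZagierProofs
import Literature.NumberTheory.EllipticCurves.KrizLi2019.SexticTwistBSDThreeDescent
import Literature.NumberTheory.EllipticCurves.GlobalMinimalModelProofs
import HarnessLib

/-!
# The EXACT-INDEX SUB-LEAF of the wild rank-one row at `3` (W-ALL row 2·3@3): a Heegner datum with
# `3 ∤ [E(K):ℤ·y_K] · ∏_ℓ c_ℓ(E) · c` makes the Heegner index EXACT by Kolyvagin's printed bound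
# alone — no main conjecture, no `p`-adic `L`-function, no control theorem, no twin — and then
# `BSD₃(E^{d_K}) ⟹ BSD₃(E)` (route-free class theorem; cell `bsd-wall`, D-0131 (3) M-UTD)

Seat `bsd-wall-utd-p3` (prover, gen 0), 2026-08-27. ROUTE-FREE (imports no `Theses.*`). Companion of
the UTD kernel `Theorems/UniversalToricDescentToricKernelAtThree.lean` (p533077, item 20390 CLOSED): there
the EXACT index at slack `v₃(c)`,
`2·v₃[E(K):ℤP] = v₃ #Ш(E/K) + 2·v₃ ∏_ℓ c_ℓ(E) + 2·v₃(c)`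
(`SchneiderFree.IndexLowerBoundLeAt ∧ SchneiderFree.Upper.IndexUpperBoundLeAt`), comes from the route's
cruxes (IMC equality by transport from a semistable twin, unit Waldspurger value, control). HERE it comes
from print, on the sub-leaf where it is certifiable:

* §1 `SchneiderFree.Exact.indexBounds_of_not_dvd_index` — GENERIC odd `p` with `ρ̄_{E,p}` onto: for a
  Heegner datum `(N, K, Dt, H, ι, P)` with `P` of infinite order and `p ∤ [E(K):ℤP]`, `p ∤ ∏_ℓ c_ℓ(E)`,
  `p ∤ c(Dt)`, Kolyvagin's bound `ord_p #Ш(E/K) ≤ 2·ord_p[E(K):ℤP]` (tree named fact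
  `Kolyvagin1990_padicValNat_card_sha_le`, McCallum 1991 §1 / Gross 1991 Thm. 1.3 (2) — NO `p ∤ N` clause,
  only `p` odd and `Gal(ℚ(E_p)/ℚ) = GL₂`) forces `ord_p #Ш(E/K) = 0`, so both index inequalities hold
  at slack `v_p(c) = 0` with every term `0`.
* §2 `SchneiderFree.Exact.bsdp_of_heegnerIndexCoprime_of_partner_bsdp` — GENERIC odd `p ∣ N` with
  `ρ̄_{E,p}` onto, `r_an(E) = 1`: such a coprime datum with odd `d_K` and `L(E^{d_K},1) ≠ 0` plus
  `BSD_p` of (a minimal model of) the twist `E^{d_K}` give `BSD_p(E)` (bsd-potss-kmc g17's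
  `bsdp_of_exactIndexManin_of_partner_bsdp`, p528239).
* §3 **`SchneiderFree.Exact.bsdp_three_of_heegnerIndexCoprime_of_wAllExclAddWildRankZero`** — THE CLASS
  THEOREM on the exact-index sub-leaf of the wild row: for `E` on `ClassO6 W 3` (wild additive `3`),
  `r_an = 1`, `ρ̄_{E,3}` onto, and ONE Heegner datum (`K` imaginary quadratic with ODD `d_K`, Heegner for
  `N_E`, `L(E^{d_K},1) ≠ 0`, `P = y_K`) with `3 ∤ [E(K):ℤP]·∏_ℓ c_ℓ(E)·c(Dt)`: the rank-zero wild leaf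
  `WAllExclAddWildRankZero` (BY NAME, as a hypothesis — it pays `BSD₃` of the twist, again a non-CM
  wild row, `r_an = 0`) gives `BSD₃(E)` (kmc g17's p528981). Published inputs as named hypotheses:
  Gross–Zagier, Kolyvagin (qualitative and the index bound), Gross–Zagier–Kolyvagin, modularity,
  GZ86 I.(7.3). NO twin, NO crux of route UTD.
* §3b `…_of_exists` — the same with the datum packaged existentially (the shape a census row instantiates:
  class ↦ one admissible odd `D` with `ord₃ I_K = 0`, `3 ∤ ∏c_ℓ`, optimal parametrisation `c = 1`).

* §4 (appended) `partner_bsdp_of_exactIndexManin_of_bsdp`, `bsdp_iff_partner_bsdp_of_exactIndexManin`,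
  `bsdp_iff_partner_bsdp_of_heegnerIndexCoprime` — the CONVERSE peel: with the index exact (by the UTD
  cruxes, or by print on the coprime sub-leaf) `BSD_p(E) ⟺ BSD_p(E^{d_K})`; route UTD's residual crux #6 is
  necessary as well as sufficient, datum by datum.

HONEST FRAMING: conditional on the named facts (hypotheses) and on the rank-zero wild leaf
`WAllExclAddWildRankZero` (hypothesis); per datum; closes no item and no class by itself (`--supports
20390`: it is the kernel's conclusion on the sub-leaf where cruxes #2–#5 are not needed). Whether a
computed «`3 ∤ I_K` at one admissible `K`» is an admissible per-class input is the referee desks' call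
(cf. x11b3's `X11b.Three.bsdp_of_heegnerIndexCertificate`, the multiplicative analogue). BSD is not
proved for any curve by this file. No definition, no named fact, no `sorry`.

References: [McCallumLMS1991] §1 Theorem (Kolyvagin), p. 296; [GrossLMS1991] Thm. 1.3 (2), Prop. 2.1;
[JetchevSkinnerWan2017] §7.4.1 (arXiv:1512.06894 p. 30); [GrossZagier1986] Thm. I.(6.3), V.§2.
-/

noncomputable section

open scoped Classical

set_option linter.dupNamespace false
set_option autoImplicit false

namespace Summit.BirchSwinnertonDyer.BirchSwinnertonDyer.Theorems.SchneiderFree.Exact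

open WeierstrassCurve NumberField IsDedekindDomain Field
  Literature.NumberTheory.EllipticCurves
  Literature.NumberTheory.EllipticCurves.ModularForms
  Literature.NumberTheory.EllipticCurves.Rank1Residual
  Literature.NumberTheory.EllipticCurves.KrizLi2019
  Summit.BirchSwinnertonDyer.Rank1Residual
  Summit.BirchSwinnertonDyer.Rank1Residual.Additive
  Summit.BirchSwinnertonDyer.Rank1Residual.X11b

/-! ### §1 Kolyvagin's bound at a coprime Heegner index makes the index EXACT (generic odd `p`) -/

/-- **Coprime Heegner index ⟹ EXACT index at slack `v_p(c) = 0`, both halves.** For an odd prime `p`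
with `ρ̄_{E,p}` onto, a Heegner field `K` for `N` and a Heegner point `P` of infinite order with
`p ∤ [E(K):ℤP]`, `p ∤ ∏_ℓ c_ℓ(E)` and `p ∤ c(Dt)`: Kolyvagin's bound `ord_p #Ш(E/K) ≤ 2·ord_p[E(K):ℤP] = 0`
(named fact `Kolyvagin1990_padicValNat_card_sha_le`, hypothesis) kills `ord_p #Ш(E/K)`, so
`SchneiderFree.IndexLowerBoundLeAt W p K P (v_p c)` and `SchneiderFree.Upper.IndexUpperBoundLeAt W p K P (v_p c)`
both read `0 ≤ 0`. [cite: McCallumLMS1991, §1 Theorem (Kolyvagin), p. 296] [cite: GrossLMS1991, §2 Prop. 2.1 (2)] -/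
theorem indexBounds_of_not_dvd_index
    {N : ℕ} [NeZero N] {W : WeierstrassCurve ℚ} [W.IsElliptic] {K : Type} [Field K] [NumberField K]
    (hB : Kolyvagin1990_padicValNat_card_sha_le N W K) {p : ℕ} [Fact p.Prime] (hp2 : p ≠ 2)
    (hρ : W.HasSurjectiveModNGaloisRep p) (hK : IsImaginaryQuadratic K)
    (hHH : SatisfiesHeegnerHypothesis N K) (Dt : ModularParametrizationData W N)
    (H : HeegnerDatum N (NumberField.discr K)) (ι : K →+* ℂ) {P : (W.baseChange K).toAffine.Point}
    (hP : WeierstrassCurve.Affine.Point.map ι.toRatAlgHom P = heegnerPointComplex Dt H)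
    (hnt : ¬ IsOfFinAddOrder P) (hI : ¬ p ∣ (AddSubgroup.zmultiples P).index)
    (htam : ¬ p ∣ W.tamagawaProduct) (hc : ¬ (p : ℤ) ∣ Dt.c) :
    IndexLowerBoundLeAt W p K P (padicValNat p Dt.c.natAbs) ∧
      Upper.IndexUpperBoundLeAt W p K P (padicValNat p Dt.c.natAbs) := by
  have hp : p.Prime := Fact.out
  have hsha : padicValNat p (Nat.card (W.baseChange K).sha) ≤
      2 * padicValNat p (AddSubgroup.zmultiples P).index :=
    hB hK hHH ⟨Dt, H, ι, hP⟩ hnt hp hp2 hρ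
  have hI0 : padicValNat p (AddSubgroup.zmultiples P).index = 0 := padicValNat.eq_zero_of_not_dvd hI
  have htam0 : padicValNat p W.tamagawaProduct = 0 := padicValNat.eq_zero_of_not_dvd htam
  have hc0 : padicValNat p Dt.c.natAbs = 0 :=
    padicValNat.eq_zero_of_not_dvd fun h ↦ hc (Int.ofNat_dvd_left.mpr h)
  have hsha0 : padicValNat p (W.baseChange K).shaOrder = 0 := by
    show padicValNat p (Nat.card (W.baseChange K).sha) = 0
    omega
  refine ⟨?_, ?_⟩
  · unfold IndexLowerBoundLeAt; omega
  · unfold Upper.IndexUpperBoundLeAt; omega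

/-! ### §2 Generic odd `p ∣ N`: coprime datum + `BSD_p` of the twist ⟹ `BSD_p(E)` -/

/-- **Coprime Heegner index + `BSD_p(E^{d_K})` ⟹ `BSD_p(E)`, any odd `p ∣ N` with `ρ̄_{E,p}` onto and
`r_an(E) = 1`.** With a Heegner datum of odd `d_K`, `L(E^{d_K},1) ≠ 0`, any globally minimal model `Wd`
of the twist, and `p ∤ [E(K):ℤP]·∏_ℓ c_ℓ(E)·c(Dt)`: §1 gives the exact index at slack `v_p(c)`, `p ∣ N`
splits in `K` so `p ∤ #𝓞_K^×`, the Heegner point is non-torsion by Gross–Zagier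
(`L′(E/K,1) = L′(E,1)·L(E^{d_K},1) ≠ 0`), and kmc g17's `bsdp_of_exactIndexManin_of_partner_bsdp`
descends. Facts by name as hypotheses. [cite: JetchevSkinnerWan2017, §7.4.1 (arXiv:1512.06894 p. 30)]
[cite: McCallumLMS1991, §1 Theorem (Kolyvagin), p. 296] [cite: GrossZagier1986, Thm. I.(6.3) and V.§2] -/
theorem bsdp_of_heegnerIndexCoprime_of_partner_bsdp
    (hGZ : ∀ (N : ℕ) [NeZero N] (W : WeierstrassCurve ℚ) (K : Type) [Field K] [NumberField K],
      gross_zagier N W K)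
    (hKo : ∀ (N : ℕ) [NeZero N] (W : WeierstrassCurve ℚ) (K : Type) [Field K] [NumberField K],
      kolyvagin N W K)
    (hB : ∀ (N : ℕ) [NeZero N] (W : WeierstrassCurve ℚ) (K : Type) [Field K] [NumberField K],
      Kolyvagin1990_padicValNat_card_sha_le N W K)
    (hGZK : rank_eq_analyticRank_of_analyticRank_le_one) (hmod : hasEntireLFunction_rat)
    (hGZ73 : GrossZagier1986_thm_I_7_3)
    (W : WeierstrassCurve ℚ) [W.IsElliptic] [W.IsGloballyMinimal] (p : ℕ) [Fact p.Prime] (hp2 : p ≠ 2)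
    (hρ : W.HasSurjectiveModNGaloisRep p) (hr : W.analyticRank = 1)
    (N : ℕ) [NeZero N] (K : Type) [Field K] [NumberField K]
    (Dt : ModularParametrizationData W N) (H : HeegnerDatum N (NumberField.discr K)) (ι : K →+* ℂ)
    (P : (W.baseChange K).toAffine.Point) (Wd : WeierstrassCurve ℚ) [Wd.IsElliptic] [Wd.IsGloballyMinimal]
    (hN : W.conductorNorm ℤ = N) (hpN : p ∣ N) (hK : IsImaginaryQuadratic K)
    (hodd : Odd (NumberField.discr K)) (hHH : SatisfiesHeegnerHypothesis N K)
    (hLd : (W.quadraticTwist (NumberField.discr K : ℚ)).entireLFunction 1 ≠ 0)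
    (hP : WeierstrassCurve.Affine.Point.map ι.toRatAlgHom P = heegnerPointComplex Dt H)
    (hC : ∃ C : VariableChange ℚ, C • W.quadraticTwist (NumberField.discr K : ℚ) = Wd)
    (hI : ¬ p ∣ (AddSubgroup.zmultiples P).index) (htam : ¬ p ∣ W.tamagawaProduct)
    (hc : ¬ (p : ℤ) ∣ Dt.c) (hWd : BSDp Wd p) :
    BSDp W p := by
  -- `p ∣ N` splits in `K`: `p ∤ #𝓞_K^×`
  have hw : ¬ p ∣ Units.torsionOrder K :=
    (X11b.Three.not_dvd_discr_and_not_dvd_torsionOrder_of_heegner hK hHH hp2 hpN).2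
  -- the Heegner point is non-torsion (Gross–Zagier)
  have hL0 : W.entireLFunction 1 = 0 := entireLFunction_one_eq_zero_of_analyticRank_eq_one hr
  obtain ⟨-, hderiv⟩ := leadingLCoeff_eq_deriv_of_analyticRank_eq_one hr
  have hLK : LDerivEK W K ≠ 0 := by
    rw [lDerivEK_eq_deriv_mul W K hmod hL0]; exact mul_ne_zero hderiv hLd
  have hnt : ¬ IsOfFinAddOrder P :=
    (lDerivEK_ne_zero_iff_not_isOfFinAddOrder W N K (hGZ N W K) hK hHH ⟨Dt, H, ι, hP⟩).mp hLK
  -- the exact index from Kolyvagin's bound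
  obtain ⟨hlo, hup⟩ := indexBounds_of_not_dvd_index (hB N W K) hp2 hρ hK hHH Dt H ι hP hnt hI htam hc
  exact bsdp_of_exactIndexManin_of_partner_bsdp hGZ hKo hGZK hmod hGZ73 W p N K Dt H ι P Wd hr hN hpN hK hodd
    hw hHH hLd hP hC hp2 hlo hup hWd

/-! ### §3 THE CLASS THEOREM on the exact-index sub-leaf of the wild rank-one row at `3` -/

/-- **The exact-index sub-leaf of W-ALL row 2·3@3 (wild additive `3`, `r_an = 1`, `ρ̄_{E,3}` onto) is paid
by the rank-zero wild leaf.** For `E` (globally minimal `W`) on `ClassO6 W 3` with `r_an(E) = 1` and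
`ρ̄_{E,3}` onto, and ONE Heegner datum `(N = N_E, K, Dt, H, ι, P)` — `K` imaginary quadratic with ODD
`d_K` satisfying the Heegner hypothesis for `N_E`, `L(E^{d_K},1) ≠ 0`, `P = y_K` — such that
`3 ∤ [E(K):ℤP]`, `3 ∤ ∏_ℓ c_ℓ(E)` and `3 ∤ c(Dt)`: the leaf `WAllExclAddWildRankZero` (hypothesis; it pays
`BSD₃` of a minimal model of `E^{d_K}`, a non-CM wild row of analytic rank `0`) gives `BSD₃(E)` — §1 +
kmc g17's `bsdp_three_of_exactIndexManin_of_wAllExclAddWildRankZero`. NO anticyclotomic main conjecture,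
NO BDP value, NO control theorem, NO semistable twin: on this sub-leaf the UTD kernel's cruxes #2–#5 are
not needed. Facts by name as hypotheses. [cite: McCallumLMS1991, §1 Theorem (Kolyvagin), p. 296]
[cite: GrossLMS1991, Thm. 1.3 (2) and Prop. 2.1] [cite: JetchevSkinnerWan2017, §7.4.1 (arXiv:1512.06894 p. 30)]
[cite: GrossZagier1986, Thm. I.(6.3) and V.§2] -/
theorem bsdp_three_of_heegnerIndexCoprime_of_wAllExclAddWildRankZero
    (hGZ : ∀ (N : ℕ) [NeZero N] (W : WeierstrassCurve ℚ) (K : Type) [Field K] [NumberField K],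
      gross_zagier N W K)
    (hKo : ∀ (N : ℕ) [NeZero N] (W : WeierstrassCurve ℚ) (K : Type) [Field K] [NumberField K],
      kolyvagin N W K)
    (hB : ∀ (N : ℕ) [NeZero N] (W : WeierstrassCurve ℚ) (K : Type) [Field K] [NumberField K],
      Kolyvagin1990_padicValNat_card_sha_le N W K)
    (hGZK : rank_eq_analyticRank_of_analyticRank_le_one) (hmod : hasEntireLFunction_rat)
    (hGZ73 : GrossZagier1986_thm_I_7_3)
    (hRZ : Summit.BirchSwinnertonDyer.WAllExclAddWildRankZero)
    (W : WeierstrassCurve ℚ) [W.IsElliptic] [W.IsGloballyMinimal]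
    (hO6 : ClassO6 W 3) (hsurj : W.HasSurjectiveModNGaloisRep 3) (hr : W.analyticRank = 1)
    (N : ℕ) [NeZero N] (K : Type) [Field K] [NumberField K]
    (Dt : ModularParametrizationData W N) (H : HeegnerDatum N (NumberField.discr K)) (ι : K →+* ℂ)
    (P : (W.baseChange K).toAffine.Point)
    (hN : W.conductorNorm ℤ = N) (hK : IsImaginaryQuadratic K) (hodd : Odd (NumberField.discr K))
    (hHH : SatisfiesHeegnerHypothesis N K)
    (hLd : (W.quadraticTwist (NumberField.discr K : ℚ)).entireLFunction 1 ≠ 0)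
    (hP : WeierstrassCurve.Affine.Point.map ι.toRatAlgHom P = heegnerPointComplex Dt H)
    (hI : ¬ 3 ∣ (AddSubgroup.zmultiples P).index) (htam : ¬ 3 ∣ W.tamagawaProduct)
    (hc : ¬ (3 : ℤ) ∣ Dt.c) :
    BSDp W 3 := by
  -- the Heegner point is non-torsion (Gross–Zagier)
  have hL0 : W.entireLFunction 1 = 0 := entireLFunction_one_eq_zero_of_analyticRank_eq_one hr
  obtain ⟨-, hderiv⟩ := leadingLCoeff_eq_deriv_of_analyticRank_eq_one hr
  have hLK : LDerivEK W K ≠ 0 := by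
    rw [lDerivEK_eq_deriv_mul W K hmod hL0]; exact mul_ne_zero hderiv hLd
  have hnt : ¬ IsOfFinAddOrder P :=
    (lDerivEK_ne_zero_iff_not_isOfFinAddOrder W N K (hGZ N W K) hK hHH ⟨Dt, H, ι, hP⟩).mp hLK
  -- the exact index at slack `v₃(c)` from Kolyvagin's bound alone
  obtain ⟨hlo, hup⟩ :=
    indexBounds_of_not_dvd_index (hB N W K) (by decide) hsurj hK hHH Dt H ι hP hnt hI htam hc
  -- a globally minimal model of the twist, then the rank-zero wild leaf via p528981
  have hD0 : (NumberField.discr K : ℚ) ≠ 0 := by exact_mod_cast NumberField.discr_ne_zero K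
  haveI : (W.quadraticTwist (NumberField.discr K : ℚ)).IsElliptic := W.isElliptic_quadraticTwist hD0
  obtain ⟨Cd, hCd⟩ := hasGlobalMinimalModel_rat_holds (W.quadraticTwist (NumberField.discr K : ℚ))
  haveI : (Cd • W.quadraticTwist (NumberField.discr K : ℚ)).IsGloballyMinimal := hCd
  exact bsdp_three_of_exactIndexManin_of_wAllExclAddWildRankZero hGZ hKo hGZK hmod hGZ73 hRZ W hO6 hsurj hr N
    K Dt H ι P (Cd • W.quadraticTwist (NumberField.discr K : ℚ)) hN hK hodd hHH hLd hP ⟨Cd, rfl⟩ hlo hup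

/-- **The same class theorem with the datum packaged existentially** — the shape a census row
instantiates (a class, one admissible odd `D` with `ord₃ I_K = 0`, `3 ∤ ∏_ℓ c_ℓ`, a parametrisation with
`3 ∤ c`): on `ClassO6 W 3 ∧ r_an = 1 ∧ ρ̄₃ onto`, the existence of such a datum and the rank-zero wild leaf
give `BSD₃(E)`. [cite: McCallumLMS1991, §1 Theorem (Kolyvagin), p. 296]
[cite: JetchevSkinnerWan2017, §7.4.1 (arXiv:1512.06894 p. 30)] -/
theorem bsdp_three_of_exists_heegnerIndexCoprime_of_wAllExclAddWildRankZero
    (hGZ : ∀ (N : ℕ) [NeZero N] (W : WeierstrassCurve ℚ) (K : Type) [Field K] [NumberField K],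
      gross_zagier N W K)
    (hKo : ∀ (N : ℕ) [NeZero N] (W : WeierstrassCurve ℚ) (K : Type) [Field K] [NumberField K],
      kolyvagin N W K)
    (hB : ∀ (N : ℕ) [NeZero N] (W : WeierstrassCurve ℚ) (K : Type) [Field K] [NumberField K],
      Kolyvagin1990_padicValNat_card_sha_le N W K)
    (hGZK : rank_eq_analyticRank_of_analyticRank_le_one) (hmod : hasEntireLFunction_rat)
    (hGZ73 : GrossZagier1986_thm_I_7_3)
    (hRZ : Summit.BirchSwinnertonDyer.WAllExclAddWildRankZero)
    (W : WeierstrassCurve ℚ) [W.IsElliptic] [W.IsGloballyMinimal] [NeZero (W.conductorNorm ℤ)]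
    (hO6 : ClassO6 W 3) (hsurj : W.HasSurjectiveModNGaloisRep 3) (hr : W.analyticRank = 1)
    (hex : ∃ (K : Type) (_ : Field K) (_ : NumberField K)
      (Dt : ModularParametrizationData W (W.conductorNorm ℤ))
      (H : HeegnerDatum (W.conductorNorm ℤ) (NumberField.discr K)) (ι : K →+* ℂ)
      (P : (W.baseChange K).toAffine.Point),
      IsImaginaryQuadratic K ∧ Odd (NumberField.discr K) ∧
        SatisfiesHeegnerHypothesis (W.conductorNorm ℤ) K ∧
        (W.quadraticTwist (NumberField.discr K : ℚ)).entireLFunction 1 ≠ 0 ∧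
        WeierstrassCurve.Affine.Point.map ι.toRatAlgHom P = heegnerPointComplex Dt H ∧
        ¬ 3 ∣ (AddSubgroup.zmultiples P).index ∧ ¬ 3 ∣ W.tamagawaProduct ∧ ¬ (3 : ℤ) ∣ Dt.c) :
    BSDp W 3 := by
  obtain ⟨K, _, _, Dt, H, ι, P, hK, hodd, hHH, hLd, hP, hI, htam, hc⟩ := hex
  exact bsdp_three_of_heegnerIndexCoprime_of_wAllExclAddWildRankZero hGZ hKo hB hGZK hmod hGZ73 hRZ W hO6
    hsurj hr (W.conductorNorm ℤ) K Dt H ι P rfl hK hodd hHH hLd hP hI htam hc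

/-! ### §4 The converse peel: with the index EXACT, `BSD_p(E) ⟺ BSD_p(E^{d_K})` (appended, gen 0) -/

open Literature.NumberTheory.EllipticCurves.Rank1Residual.Typed

/-- **Exact Heegner index at slack `v_p(c)` + `BSD_p(E)` ⟹ `BSD_p(E^{d_K})`** — the CONVERSE of kmc g17's
`bsdp_of_exactIndexManin_of_partner_bsdp`, any odd `p ∣ N`, `r_an(E) = 1`, Heegner datum with odd `d_K`,
`p ∤ #𝓞_K^×`, `L(E^{d_K},1) ≠ 0`, `Wd` a globally minimal model of the twist: the two JOINT halves over
`(W, Wd)` (`jointLowerBoundAt_of_stepL_manin`, `Upper.jointUpperBoundAt_of_coStepL_manin`) are SYMMETRIC in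
the pair, so `W`'s two halves (`BSDp W p`, `Ш(W)` finite by Gross–Zagier–Kolyvagin) peel off `Wd`'s
(`Typed.missingLowerBoundAt_of_joint_of_upper`, `Upper.missingUpperBoundAt_of_jointUpper_of_lower`), and
`Typed.bsdp_of_missingPPartAt` concludes in analytic rank `0`. So on every datum where the UTD kernel (or
print) makes the index exact, the rank-zero wild row of the twist is not only sufficient but NECESSARY for
`BSD_p(E)`. Facts by name as hypotheses. [cite: GrossZagier1986, Thm. I.(6.3) and (7.3)]
[cite: JetchevSkinnerWan2017, §7.4.1 (arXiv:1512.06894 p. 30)] [cite: Miller2011LMS, Def. 1.1] -/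
theorem partner_bsdp_of_exactIndexManin_of_bsdp
    (hGZ : ∀ (N : ℕ) [NeZero N] (W : WeierstrassCurve ℚ) (K : Type) [Field K] [NumberField K],
      gross_zagier N W K)
    (hKo : ∀ (N : ℕ) [NeZero N] (W : WeierstrassCurve ℚ) (K : Type) [Field K] [NumberField K],
      kolyvagin N W K)
    (hGZK : rank_eq_analyticRank_of_analyticRank_le_one) (hmod : hasEntireLFunction_rat)
    (hGZ73 : GrossZagier1986_thm_I_7_3)
    (W : WeierstrassCurve ℚ) [W.IsElliptic] [W.IsGloballyMinimal] (p : ℕ) [Fact p.Prime]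
    (N : ℕ) [NeZero N] (K : Type) [Field K] [NumberField K]
    (Dt : ModularParametrizationData W N) (H : HeegnerDatum N (NumberField.discr K)) (ι : K →+* ℂ)
    (P : (W.baseChange K).toAffine.Point) (Wd : WeierstrassCurve ℚ) [Wd.IsElliptic] [Wd.IsGloballyMinimal]
    (hr : W.analyticRank = 1) (hN : W.conductorNorm ℤ = N) (hpN : p ∣ N) (hK : IsImaginaryQuadratic K)
    (hodd : Odd (NumberField.discr K)) (hw : ¬ p ∣ Units.torsionOrder K)
    (hHH : SatisfiesHeegnerHypothesis N K)
    (hLd : (W.quadraticTwist (NumberField.discr K : ℚ)).entireLFunction 1 ≠ 0)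
    (hP : WeierstrassCurve.Affine.Point.map ι.toRatAlgHom P = heegnerPointComplex Dt H)
    (hC : ∃ C : VariableChange ℚ, C • W.quadraticTwist (NumberField.discr K : ℚ) = Wd)
    (hp2 : p ≠ 2) (hlo : IndexLowerBoundLeAt W p K P (padicValNat p Dt.c.natAbs))
    (hup : Upper.IndexUpperBoundLeAt W p K P (padicValNat p Dt.c.natAbs))
    (hW : BSDp W p) :
    BSDp Wd p := by
  -- the two joint halves, and their symmetry in the pair
  have hJlo : JointLowerBoundAt W Wd p :=
    jointLowerBoundAt_of_stepL_manin hGZ hKo hGZK hmod hGZ73 W p N K Dt H ι P Wd hr hN hpN hK hodd hw hHH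
      hLd hP hC hp2 hlo
  have hJup : Upper.JointUpperBoundAt W Wd p :=
    Upper.jointUpperBoundAt_of_coStepL_manin hGZ hKo hGZK hmod hGZ73 W p N K Dt H ι P Wd hr hN hpN hK hodd
      hw hHH hLd hP hC hp2 hup
  have hJlo' : JointLowerBoundAt Wd W p := by
    obtain ⟨q, qd, hq, hqd, hle⟩ := hJlo
    exact ⟨qd, q, hqd, hq, by omega⟩
  have hJup' : Upper.JointUpperBoundAt Wd W p := by
    obtain ⟨q, qd, hq, hqd, hle⟩ := hJup
    exact ⟨qd, q, hqd, hq, by omega⟩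
  -- `W`'s halves from `BSDp W p` (`Ш(W)` finite in analytic rank one)
  obtain ⟨-, hfinW⟩ := hGZK W (by rw [hr])
  haveI : Finite W.sha := hfinW
  obtain ⟨hWlo, hWup⟩ := lower_and_upper_of_missingPPartAt W p (missingPPartAt_of_bsdp W p hW)
  -- peel: the partner's halves
  have hdlo : MissingLowerBoundAt Wd p := missingLowerBoundAt_of_joint_of_upper hJlo' hWup
  have hdup : MissingUpperBoundAt Wd p := Upper.missingUpperBoundAt_of_jointUpper_of_lower hJup' hWlo
  -- the twist has analytic rank zero
  obtain ⟨Cd, hCd⟩ := hC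
  have hD0 : (NumberField.discr K : ℚ) ≠ 0 := by exact_mod_cast NumberField.discr_ne_zero K
  haveI : (W.quadraticTwist (NumberField.discr K : ℚ)).IsElliptic := W.isElliptic_quadraticTwist hD0
  have hLd1 : Wd.entireLFunction 1 ≠ 0 := by rw [← hCd, entireLFunction_smul]; exact hLd
  have hrd : Wd.analyticRank = 0 := analyticRank_eq_zero_of_entireLFunction_one_ne_zero Wd hLd1
  exact bsdp_of_missingPPartAt Wd p hGZK (by rw [hrd]; exact zero_le_one)
    (missingPPartAt_of_lower_of_upper Wd p hdlo hdup)

/-- **With the Heegner index EXACT at slack `v_p(c)`, `BSD_p(E) ⟺ BSD_p(E^{d_K})`** (odd `p ∣ N`,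
`r_an(E) = 1`, datum as above): kmc g17's descent and §4's converse peel. The currency statement behind
route UTD's residual crux `WildRankZeroTwistAtThree`: granted cruxes #2–#5 (which make the index exact on
the cell), the rank-zero wild rows of the twists are EQUIVALENT to the rank-one rows, datum by datum.
[cite: JetchevSkinnerWan2017, §7.4.1 (arXiv:1512.06894 p. 30)] [cite: GrossZagier1986, Thm. I.(6.3) and (7.3)] -/
theorem bsdp_iff_partner_bsdp_of_exactIndexManin
    (hGZ : ∀ (N : ℕ) [NeZero N] (W : WeierstrassCurve ℚ) (K : Type) [Field K] [NumberField K],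
      gross_zagier N W K)
    (hKo : ∀ (N : ℕ) [NeZero N] (W : WeierstrassCurve ℚ) (K : Type) [Field K] [NumberField K],
      kolyvagin N W K)
    (hGZK : rank_eq_analyticRank_of_analyticRank_le_one) (hmod : hasEntireLFunction_rat)
    (hGZ73 : GrossZagier1986_thm_I_7_3)
    (W : WeierstrassCurve ℚ) [W.IsElliptic] [W.IsGloballyMinimal] (p : ℕ) [Fact p.Prime]
    (N : ℕ) [NeZero N] (K : Type) [Field K] [NumberField K]
    (Dt : ModularParametrizationData W N) (H : HeegnerDatum N (NumberField.discr K)) (ι : K →+* ℂ)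
    (P : (W.baseChange K).toAffine.Point) (Wd : WeierstrassCurve ℚ) [Wd.IsElliptic] [Wd.IsGloballyMinimal]
    (hr : W.analyticRank = 1) (hN : W.conductorNorm ℤ = N) (hpN : p ∣ N) (hK : IsImaginaryQuadratic K)
    (hodd : Odd (NumberField.discr K)) (hw : ¬ p ∣ Units.torsionOrder K)
    (hHH : SatisfiesHeegnerHypothesis N K)
    (hLd : (W.quadraticTwist (NumberField.discr K : ℚ)).entireLFunction 1 ≠ 0)
    (hP : WeierstrassCurve.Affine.Point.map ι.toRatAlgHom P = heegnerPointComplex Dt H)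
    (hC : ∃ C : VariableChange ℚ, C • W.quadraticTwist (NumberField.discr K : ℚ) = Wd)
    (hp2 : p ≠ 2) (hlo : IndexLowerBoundLeAt W p K P (padicValNat p Dt.c.natAbs))
    (hup : Upper.IndexUpperBoundLeAt W p K P (padicValNat p Dt.c.natAbs)) :
    BSDp W p ↔ BSDp Wd p :=
  ⟨partner_bsdp_of_exactIndexManin_of_bsdp hGZ hKo hGZK hmod hGZ73 W p N K Dt H ι P Wd hr hN hpN hK hodd hw
      hHH hLd hP hC hp2 hlo hup,
    bsdp_of_exactIndexManin_of_partner_bsdp hGZ hKo hGZK hmod hGZ73 W p N K Dt H ι P Wd hr hN hpN hK hodd hw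
      hHH hLd hP hC hp2 hlo hup⟩

/-- **On the coprime sub-leaf, `BSD_p(E) ⟺ BSD_p(E^{d_K})` from print alone** (odd `p ∣ N`, `ρ̄_{E,p}`
onto, `r_an(E) = 1`, ONE Heegner datum with odd `d_K`, `L(E^{d_K},1) ≠ 0` and `p ∤ [E(K):ℤP]·∏_ℓ c_ℓ(E)·c(Dt)`):
§1 (Kolyvagin's printed bound makes the index exact) + `bsdp_iff_partner_bsdp_of_exactIndexManin`; the
Heegner point is non-torsion by Gross–Zagier and `p ∤ #𝓞_K^×` since `p ∣ N` splits. The rank-one class and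
the rank-zero class of its twist are ONE problem on this sub-leaf. [cite: McCallumLMS1991, §1 Theorem (Kolyvagin), p. 296]
[cite: JetchevSkinnerWan2017, §7.4.1 (arXiv:1512.06894 p. 30)] [cite: GrossZagier1986, Thm. I.(6.3) and V.§2] -/
theorem bsdp_iff_partner_bsdp_of_heegnerIndexCoprime
    (hGZ : ∀ (N : ℕ) [NeZero N] (W : WeierstrassCurve ℚ) (K : Type) [Field K] [NumberField K],
      gross_zagier N W K)
    (hKo : ∀ (N : ℕ) [NeZero N] (W : WeierstrassCurve ℚ) (K : Type) [Field K] [NumberField K],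
      kolyvagin N W K)
    (hB : ∀ (N : ℕ) [NeZero N] (W : WeierstrassCurve ℚ) (K : Type) [Field K] [NumberField K],
      Kolyvagin1990_padicValNat_card_sha_le N W K)
    (hGZK : rank_eq_analyticRank_of_analyticRank_le_one) (hmod : hasEntireLFunction_rat)
    (hGZ73 : GrossZagier1986_thm_I_7_3)
    (W : WeierstrassCurve ℚ) [W.IsElliptic] [W.IsGloballyMinimal] (p : ℕ) [Fact p.Prime] (hp2 : p ≠ 2)
    (hρ : W.HasSurjectiveModNGaloisRep p) (hr : W.analyticRank = 1)
    (N : ℕ) [NeZero N] (K : Type) [Field K] [NumberField K]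
    (Dt : ModularParametrizationData W N) (H : HeegnerDatum N (NumberField.discr K)) (ι : K →+* ℂ)
    (P : (W.baseChange K).toAffine.Point) (Wd : WeierstrassCurve ℚ) [Wd.IsElliptic] [Wd.IsGloballyMinimal]
    (hN : W.conductorNorm ℤ = N) (hpN : p ∣ N) (hK : IsImaginaryQuadratic K)
    (hodd : Odd (NumberField.discr K)) (hHH : SatisfiesHeegnerHypothesis N K)
    (hLd : (W.quadraticTwist (NumberField.discr K : ℚ)).entireLFunction 1 ≠ 0)
    (hP : WeierstrassCurve.Affine.Point.map ι.toRatAlgHom P = heegnerPointComplex Dt H)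
    (hC : ∃ C : VariableChange ℚ, C • W.quadraticTwist (NumberField.discr K : ℚ) = Wd)
    (hI : ¬ p ∣ (AddSubgroup.zmultiples P).index) (htam : ¬ p ∣ W.tamagawaProduct)
    (hc : ¬ (p : ℤ) ∣ Dt.c) :
    BSDp W p ↔ BSDp Wd p := by
  have hw : ¬ p ∣ Units.torsionOrder K :=
    (X11b.Three.not_dvd_discr_and_not_dvd_torsionOrder_of_heegner hK hHH hp2 hpN).2
  have hL0 : W.entireLFunction 1 = 0 := entireLFunction_one_eq_zero_of_analyticRank_eq_one hr
  obtain ⟨-, hderiv⟩ := leadingLCoeff_eq_deriv_of_analyticRank_eq_one hr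
  have hLK : LDerivEK W K ≠ 0 := by
    rw [lDerivEK_eq_deriv_mul W K hmod hL0]; exact mul_ne_zero hderiv hLd
  have hnt : ¬ IsOfFinAddOrder P :=
    (lDerivEK_ne_zero_iff_not_isOfFinAddOrder W N K (hGZ N W K) hK hHH ⟨Dt, H, ι, hP⟩).mp hLK
  obtain ⟨hlo, hup⟩ := indexBounds_of_not_dvd_index (hB N W K) hp2 hρ hK hHH Dt H ι hP hnt hI htam hc
  exact bsdp_iff_partner_bsdp_of_exactIndexManin hGZ hKo hGZK hmod hGZ73 W p N K Dt H ι P Wd hr hN hpN hK hodd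
    hw hHH hLd hP hC hp2 hlo hup

end Summit.BirchSwinnertonDyer.BirchSwinnertonDyer.Theorems.SchneiderFree.Exact

end
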